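import Literature.Probability.RandomPlanarGeometry.HexSAWBrickWallStripFugacityWidthOneComplexTwoTerm
import Literature.Probability.RandomPlanarGeometry.HexSAWBrickWallStripFugacityWidthOneComplexCumulants
import Literature.Probability.RandomPlanarGeometry.HexSAWBrickWallStripFugacityWidthOneComplexFugacity
import Literature.Probability.RandomPlanarGeometry.HexSAWBrickWallStripFugacityWidthOneContactMoments
import Literature.Probability.Independence.BerryEsseenTwoWindows
import Literature.Probability.Independence.BerryEsseenComplexTilt
import HarnessLib

/-!
# The Berry–Esseen rate for the number of surface contacts of the width-one strip:
# `sup_x |P_{N,y,z}(bc ≤ N b + x σ √N) − Φ(x)| ≤ C/√N`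

Topic `Literature/Probability/RandomPlanarGeometry` (ASSEMBLY of the complex-fugacity programme of DOOR-ap5-g27 item 1: `…WidthOneComplexTwoTerm.lean`
(`exists_complex_two_term_real_amplitude`: `C_{1,2M+c}(ye^{it},z) = A(t)s(t)^M + O((M+1)Θ^M)` uniformly in `|t| < t₀` with `A(t) = A₀ + O(t)`, `A₀ > 0`),
`…WidthOneComplexTaylor.lean` (`exists_norm_log_root_div_sub_le`: `‖log(s(t)/s) − iαt + γt²‖ ≤ K|t|³`), `…WidthOneComplexCumulants.lean` (`α = 2b(y,z)`,
`γ = σ²`), `…WidthOneComplexFugacity.lean` (`charFun_contactLaw`: the characteristic function IS the partition-function quotient at fugacity `ye^{iθ/√N}`),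
`…WidthOneContactMoments.lean` (bounded second moments), and the model-free Berry–Esseen files `Literature/Probability/Independence/BerryEsseenComplexTilt.lean`
(`norm_sub_gauss_le_of_cubic_mul`) and `BerryEsseenTwoWindows.lean` (`abs_cdf_sub_gaussian_le_rate_two_windows`)).

* §1 The standardised law `law((bc − Nb)/(σ√N))` as a pushforward of `contactLaw`: `charFun_contactLaw_map`, `contactLaw_map_real_Iic`; ★ `exists_inner_window`
  (`‖φ_N(θ) − e^{−θ²/2}‖ ≤ A₁|θ|` on `|θ| ≤ 1`, all `N`, from the bounded second moment).
* §2 Two pure lemmas: `charFun_shape` (the exact factorisation `C_N(w)/C_N(y)·e^{−iθ√N b/σ} = e^{−θ²/2 + E}·q`) and `norm_ratio_le` (the geometric factor `q`).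
* §3 ★★ `exists_outer_window` — for each parity `c`: `δ, K_c, K′, N₀` with `4K_cδ ≤ 1` such that for `N ≥ N₀`, `N ≡ c (2)`, `1/√N < |θ| < δ√N`:
  `φ_N(θ) = e^{−θ²/2+E}q`, `‖E‖ ≤ K_c(|θ|+|θ|³)/√N`, `‖q‖ ≤ 2`, `‖q − 1‖ ≤ K′|θ|/√N`.
* §4 ★★★ `contact_berryEsseen`: for all `y, z > 0` there is `C` with `|P_{N,y,z}(bc ≤ N·b(y,z) + x·σ·√N) − Φ(x)| ≤ C/√N` for EVERY `N ≥ 1` and EVERY real `x`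
  (`σ² = ∂b/∂A`, `Φ` the standard normal distribution function) — the rate companion of `tendsto_contactCDF`; `contact_berryEsseen'` (the same in the units
  of `tendsto_contactCDF`: `|P(bc ≤ Nb + x√N) − N(0,σ²)(−∞,x]| ≤ C/√N`); ★★★ `topContact_berryEsseen` (the top wall, by the reflection exchanging the walls).

## Sources
R. Durrett, *Probability: Theory and Examples* (2019) §3.4.4 Theorem 3.4.17 (the Berry–Esseen theorem; here for a dependent lattice statistic via its rational
generating function); W. Feller II (1971) XVI.5; N. R. Beaton, M. Bousquet-Mélou, J. de Gier, H. Duminil-Copin, A. J. Guttmann, CMP 326 (2014), arXiv:1109.0358v5 §3.2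
Proposition 6 (p. 10: `C_{T,N}(y,z)`, `μ₁(y,z)`); R. P. Stanley, EC1 §4.1 Theorem 4.1.1 (iii).  Lane statements (lane «pcv-sawmu», a-p5 g28); nothing is quoted AS PRINTED.
-/

noncomputable section

open MeasureTheory ProbabilityTheory Filter Finset Complex Set
open Literature.Probability.LatticeModels Literature.Probability.Percolation Literature.Probability.Independence
open scoped Topology

namespace Literature.Probability.RandomPlanarGeometry.SAW.HexBW

namespace WidthOneYZ

variable {y z : ℝ}

/-! ## §1 The standardised law and the inner window -/

/-- The characteristic function of the scaled law `law(a·(bc − Nb)/√N)`: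
`φ(θ) = C_{1,N}(y e^{iaθ/√N}, z)/C_{1,N}(y,z) · e^{−iaθ√N b}` (`charFun_map_mul` + `charFun_contactLaw`).
[cite: Durrett2019, §3.3 Theorem 3.3.1 (lane plumbing); BeatonBousquetMelouDeGierDuminilCopinGuttmann2014, §3.2 Proposition 6 (arXiv v5 p. 10)] -/
theorem charFun_contactLaw_map (hy : 0 < y) (hz : 0 < z) (N : ℕ) (a θ : ℝ) :
    charFun ((contactLaw y z N).map (fun x => a * x)) θ =
      stripZ₂C 1 N ((y : ℂ) * cexp (((a * θ : ℝ) : ℂ) / (Real.sqrt N : ℂ) * I)) (z : ℂ) / ((stripZ₂ 1 N y z : ℝ) : ℂ)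
        * cexp (-(((a * θ : ℝ) : ℂ) * (Real.sqrt N : ℂ) * (contactB y z : ℂ) * I)) := by
  rw [charFun_map_mul, charFun_contactLaw hy hz]

/-- The distribution function of the scaled law: for `a > 0` and `N ≥ 1`,
`law(a(bc − Nb)/√N)(−∞, x] = P_{N,y,z}(bc ≤ N b + (x/a)√N)`. [cite: Durrett2019, §3.2 (lane plumbing); BeatonBousquetMelouDeGierDuminilCopinGuttmann2014, §3.2] -/
theorem contactLaw_map_real_Iic (hy : 0 < y) (hz : 0 < z) {N : ℕ} (hN : 1 ≤ N) {a : ℝ} (ha : 0 < a) (x : ℝ) :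
    ((contactLaw y z N).map (fun u => a * u)).real (Iic x) =
      (∑ q ∈ (stripPairs 1 N).filter (fun q => (bottomVisits₀ q.1 q.2 N : ℝ) ≤ N * contactB y z + x / a * Real.sqrt N), wgt y z N q)
        / stripZ₂ 1 N y z := by
  rw [map_measureReal_apply (measurable_const_mul a) measurableSet_Iic]
  have hpre : (fun u : ℝ => a * u) ⁻¹' Iic x = Iic (x / a) := by
    ext u
    simp only [Set.mem_preimage, Set.mem_Iic]
    rw [le_div_iff₀ ha, mul_comm]
  rw [hpre, contactLaw_real_Iic hy hz hN]

/-- The scaled law is a probability measure. [cite: Durrett2019, §3.2 (lane plumbing)] -/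
theorem isProbabilityMeasure_contactLaw_map (hy : 0 < y) (hz : 0 < z) (N : ℕ) (a : ℝ) :
    IsProbabilityMeasure ((contactLaw y z N).map (fun u => a * u)) :=
  haveI := isProbabilityMeasure_contactLaw hy hz N
  Measure.isProbabilityMeasure_map (measurable_const_mul a).aemeasurable

/-- ★ **THE INNER WINDOW**: for `a > 0` there is `A₁ ≥ 0` with `‖φ_{law(a(bc−Nb)/√N)}(θ) − e^{−θ²/2}‖ ≤ A₁|θ|` for ALL `N` and all `|θ| ≤ 1`
(first absolute moment `≤ a(1 + E[X_N²])`, and `E[X_N²] = E[(bc − Nb)²]/N` is bounded: it converges, `tendsto_contactMoment_even`).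
[cite: Durrett2019, §3.3 display (3.3.3) (lane statement); Curtiss1942, Theorem 3] -/
theorem exists_inner_window (hy : 0 < y) (hz : 0 < z) {a : ℝ} (ha : 0 < a) :
    ∃ A₁ : ℝ, 0 ≤ A₁ ∧ ∀ N : ℕ, ∀ θ : ℝ, |θ| ≤ 1 →
      ‖charFun ((contactLaw y z N).map (fun u => a * u)) θ - cexp (-((θ : ℂ) ^ 2 / 2))‖ ≤ A₁ * |θ| := by
  -- bounded second moments
  set f : ℕ → ℝ := fun N => ∑ q ∈ stripPairs 1 N, wgt y z N q / stripZ₂ 1 N y z *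
      (((bottomVisits₀ q.1 q.2 N : ℝ) - N * contactB y z) / Real.sqrt N) ^ (2 * 1) with hf
  have hlim := tendsto_contactMoment_even hy hz 1
  obtain ⟨B, hB⟩ := hlim.bddAbove_range
  have hB' : ∀ N, f N ≤ B := fun N => hB ⟨N, rfl⟩
  have hf0 : ∀ N, 0 ≤ f N := fun N => Finset.sum_nonneg fun q hq =>
    mul_nonneg (wgt_div_nonneg hy hz N q hq) (Even.pow_nonneg (even_two_mul 1) _)
  have hB0 : 0 ≤ B := (hf0 0).trans (hB' 0)
  refine ⟨a * (1 + B) + 1 / 2, by positivity, fun N θ hθ => ?_⟩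
  haveI := isProbabilityMeasure_contactLaw hy hz N
  haveI := isProbabilityMeasure_contactLaw_map hy hz N a
  have hint : Integrable (fun x : ℝ => x) ((contactLaw y z N).map (fun u => a * u)) := by
    refine (integrable_map_measure (by fun_prop) (measurable_const_mul a).aemeasurable).2 ?_
    exact integrable_finLaw _ _ _ _
  have h := norm_charFun_sub_gauss_le_linear hint hθ
  refine h.trans (mul_le_mul_of_nonneg_right ?_ (abs_nonneg θ))
  -- the first absolute moment
  have hmom : ∫ x, |x| ∂((contactLaw y z N).map (fun u => a * u)) ≤ a * (1 + B) := by
    rw [integral_map (measurable_const_mul a).aemeasurable (by fun_prop)]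
    change ∫ u, |a * u| ∂(contactLaw y z N) ≤ _
    rw [integral_contactLaw hy hz N (fun u => |a * u|)]
    have hsum1 : ∑ q ∈ stripPairs 1 N, wgt y z N q / stripZ₂ 1 N y z = 1 := by
      rw [← Finset.sum_div, ← stripZ₂_one_eq_sum_wgt, div_self (stripZ₂_pos 1 N hy hz).ne']
    calc ∑ q ∈ stripPairs 1 N, wgt y z N q / stripZ₂ 1 N y z *
          |a * (((bottomVisits₀ q.1 q.2 N : ℝ) - N * contactB y z) / Real.sqrt N)|
        ≤ ∑ q ∈ stripPairs 1 N, wgt y z N q / stripZ₂ 1 N y z *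
          (a * (1 + (((bottomVisits₀ q.1 q.2 N : ℝ) - N * contactB y z) / Real.sqrt N) ^ (2 * 1))) := by
          refine Finset.sum_le_sum fun q hq => mul_le_mul_of_nonneg_left ?_ (wgt_div_nonneg hy hz N q hq)
          rw [abs_mul, abs_of_pos ha]
          refine mul_le_mul_of_nonneg_left ?_ ha.le
          set X := ((bottomVisits₀ q.1 q.2 N : ℝ) - N * contactB y z) / Real.sqrt N
          rw [show (2 * 1 : ℕ) = 2 by norm_num]
          nlinarith [abs_nonneg X, sq_abs X, sq_nonneg (|X| - 1)]
      _ = a * (∑ q ∈ stripPairs 1 N, wgt y z N q / stripZ₂ 1 N y z + f N) := by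
          rw [hf, ← Finset.sum_add_distrib, Finset.mul_sum]
          refine Finset.sum_congr rfl fun q _ => ?_
          ring
      _ ≤ a * (1 + B) := by rw [hsum1]; exact mul_le_mul_of_nonneg_left (by linarith [hB' N]) ha.le
  linarith

/-! ## §2 Two pure lemmas: the exact factorisation and the geometric factor -/

/-- **The exact factorisation of the characteristic function** (pure algebra): with `A, A₀, s, s', C_y ≠ 0`,
`C_w/C_y · e^{φ} = exp(−θ²/2 + E)·q` for `E = M·log(s'/s) + log(A/A₀) + φ + θ²/2` and `q = (C_w/(A s'^M))/(C_y/(A₀ s^M))`.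
[cite: Durrett2019, proof of Theorem 3.4.17 (lane statement: the transfer-matrix form of the characteristic function)] -/
theorem charFun_shape {Cw Cy A A₀ s s' φ : ℂ} {θ : ℝ} {M : ℕ} (hCy : Cy ≠ 0) (hA : A ≠ 0) (hA₀ : A₀ ≠ 0) (hs : s ≠ 0) (hs' : s' ≠ 0) :
    Cw / Cy * cexp φ
      = cexp (-((θ : ℂ) ^ 2 / 2) + ((M : ℂ) * Complex.log (s' / s) + Complex.log (A / A₀) + φ + (θ : ℂ) ^ 2 / 2))
        * ((Cw / (A * s' ^ M)) / (Cy / (A₀ * s ^ M))) := by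
  have h1 : cexp ((M : ℂ) * Complex.log (s' / s)) = (s' / s) ^ M := by
    rw [Complex.exp_nat_mul, Complex.exp_log (div_ne_zero hs' hs)]
  have h2 : cexp (Complex.log (A / A₀)) = A / A₀ := Complex.exp_log (div_ne_zero hA hA₀)
  have hsplit : -((θ : ℂ) ^ 2 / 2) + ((M : ℂ) * Complex.log (s' / s) + Complex.log (A / A₀) + φ + (θ : ℂ) ^ 2 / 2)
      = (M : ℂ) * Complex.log (s' / s) + Complex.log (A / A₀) + φ := by ring
  rw [hsplit, Complex.exp_add, Complex.exp_add, h1, h2, div_pow]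
  field_simp

/-- **The geometric factor**: if `‖ε₁‖ ≤ η`, `‖ε₀‖ ≤ η`, `η ≤ 1/4` then `q = (1+ε₁)/(1+ε₀)` has `‖q‖ ≤ 2` and `‖q − 1‖ ≤ 4η`.
[cite: Durrett2019, proof of Theorem 3.4.17 (lane plumbing)] -/
theorem norm_ratio_le {ε₁ ε₀ : ℂ} {η : ℝ} (h1 : ‖ε₁‖ ≤ η) (h0 : ‖ε₀‖ ≤ η) (hη : η ≤ 1 / 4) :
    ‖(1 + ε₁) / (1 + ε₀)‖ ≤ 2 ∧ ‖(1 + ε₁) / (1 + ε₀) - 1‖ ≤ 4 * η := by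
  have hη0 : 0 ≤ η := (norm_nonneg _).trans h1
  have hden : 3 / 4 ≤ ‖1 + ε₀‖ := by
    have := norm_sub_norm_le (1 : ℂ) (-ε₀)
    rw [norm_one, norm_neg, sub_neg_eq_add] at this
    linarith
  have hden0 : (1 + ε₀) ≠ 0 := by
    intro h; rw [h, norm_zero] at hden; linarith
  constructor
  · rw [norm_div, div_le_iff₀ (by linarith)]
    calc ‖1 + ε₁‖ ≤ ‖(1 : ℂ)‖ + ‖ε₁‖ := norm_add_le _ _
      _ ≤ 1 + η := by rw [norm_one]; linarith
      _ ≤ 2 * ‖1 + ε₀‖ := by linarith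
  · have e : (1 + ε₁) / (1 + ε₀) - 1 = (ε₁ - ε₀) / (1 + ε₀) := by field_simp; ring
    rw [e, norm_div, div_le_iff₀ (by linarith)]
    calc ‖ε₁ - ε₀‖ ≤ ‖ε₁‖ + ‖ε₀‖ := norm_sub_le _ _
      _ ≤ 2 * η := by linarith
      _ ≤ 4 * η * ‖1 + ε₀‖ := by nlinarith

/-! ## §3 ★★ The outer window -/

/-- Geometric decay beats any polynomial: `∃ M₀, ∀ M ≥ M₀, C·(M+1)(2M+c+1)ϑ^M ≤ 1` for `0 ≤ ϑ < 1`. [cite: Durrett2019, proof of Theorem 3.4.17 (lane plumbing)] -/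
private theorem eventually_poly_geom_le_one (C : ℝ) {ϑ : ℝ} (hϑ0 : 0 ≤ ϑ) (hϑ1 : ϑ < 1) (c : ℕ) :
    ∃ M₀ : ℕ, ∀ M : ℕ, M₀ ≤ M → C * (((M : ℝ) + 1) * (((2 * M + c : ℕ) : ℝ) + 1)) * ϑ ^ M ≤ 1 := by
  have h2 := tendsto_pow_const_mul_const_pow_of_lt_one 2 hϑ0 hϑ1
  have h1 := tendsto_pow_const_mul_const_pow_of_lt_one 1 hϑ0 hϑ1
  have h0 := tendsto_pow_atTop_nhds_zero_of_lt_one hϑ0 hϑ1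
  have hsum : Tendsto (fun M : ℕ => C * (2 * ((M : ℝ) ^ 2 * ϑ ^ M) + ((c : ℝ) + 3) * ((M : ℝ) ^ 1 * ϑ ^ M) + ((c : ℝ) + 1) * ϑ ^ M))
      atTop (𝓝 (C * (2 * 0 + ((c : ℝ) + 3) * 0 + ((c : ℝ) + 1) * 0))) :=
    (((h2.const_mul 2).add (h1.const_mul _)).add (h0.const_mul _)).const_mul C
  simp only [mul_zero, add_zero] at hsum
  have hev := hsum.eventually (ge_mem_nhds zero_lt_one)
  obtain ⟨M₀, hM₀⟩ := eventually_atTop.1 hev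
  refine ⟨M₀, fun M hM => ?_⟩
  have h := hM₀ M hM
  have e : C * (((M : ℝ) + 1) * (((2 * M + c : ℕ) : ℝ) + 1)) * ϑ ^ M
      = C * (2 * ((M : ℝ) ^ 2 * ϑ ^ M) + ((c : ℝ) + 3) * ((M : ℝ) ^ 1 * ϑ ^ M) + ((c : ℝ) + 1) * ϑ ^ M) := by
    push_cast; ring
  rw [e]; exact h

/-- `θ² ≤ |θ| + |θ|³`. [cite: Durrett2019, proof of Theorem 3.4.17 (lane plumbing)] -/
private theorem sq_le_abs_add_abs_cube (θ : ℝ) : θ ^ 2 ≤ |θ| + |θ| ^ 3 := by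
  have h0 : 0 ≤ |θ| := abs_nonneg θ
  rw [← sq_abs]
  nlinarith [sq_nonneg (|θ| - 1), h0]

set_option maxHeartbeats 400000 in
-- budget line: one long bookkeeping proof (explicit constants, no search tactics).
/-- ★★ **THE OUTER WINDOW** for the parity class `N ≡ c`: there are `δ > 0`, `K_c ≥ 0`, `N₀` with `4K_cδ ≤ 1` such that for `N = 2M + c ≥ N₀` and
`1/√N < |θ| < δ√N` the characteristic function of `law((bc − Nb)/(σ√N))` has the form `e^{−θ²/2 + E}·q` with `‖E‖ ≤ K_c(|θ| + |θ|³)/√N`, `‖q‖ ≤ 2`,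
`‖q − 1‖ ≤ |θ|/√N` — `E = M·log(s(t)/s) + log(A(t)/A₀) − iθ√N b/σ + θ²/2` at `t = θ/(σ√N)` (cubic by `exists_norm_log_root_div_sub_le` with `α = 2b`,
`γ = σ²`: `…ComplexCumulants`), `q` the quotient of the two geometric remainders of `exists_complex_two_term_real_amplitude` (`|θ| > 1/√N` absorbs it).
[cite: Durrett2019, §3.4.4 proof of Theorem 3.4.17 (lane statement: transfer-matrix statistic); BeatonBousquetMelouDeGierDuminilCopinGuttmann2014, §3.2 Proposition 6 (arXiv v5 p. 10)] -/
theorem exists_outer_window (hy : 0 < y) (hz : 0 < z) (c : ℕ) :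
    ∃ δ Kc : ℝ, ∃ N₀ : ℕ, 0 < δ ∧ 0 ≤ Kc ∧ 4 * Kc * δ ≤ 1 ∧
      ∀ M : ℕ, N₀ ≤ 2 * M + c → ∀ θ : ℝ, 1 / Real.sqrt ((2 * M + c : ℕ) : ℝ) < |θ| → |θ| < δ * Real.sqrt ((2 * M + c : ℕ) : ℝ) →
        ∃ E q : ℂ,
          charFun ((contactLaw y z (2 * M + c)).map
              (fun u => (Real.sqrt (deriv (fun A => contactB (Real.exp A) z) (Real.log y)))⁻¹ * u)) θ
            = cexp (-((θ : ℂ) ^ 2 / 2) + E) * q ∧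
          ‖E‖ ≤ Kc * (|θ| + |θ| ^ 3) / Real.sqrt ((2 * M + c : ℕ) : ℝ) ∧ ‖q‖ ≤ 2 ∧
          ‖q - 1‖ ≤ 1 * |θ| / Real.sqrt ((2 * M + c : ℕ) : ℝ) := by
  -- the variance and the cumulants
  set σ2 := deriv (fun A => contactB (Real.exp A) z) (Real.log y) with hσ2
  have hσ2pos : 0 < σ2 := deriv_contactB_exp_pos hy hz
  set σ := Real.sqrt σ2 with hσ
  have hσpos : 0 < σ := Real.sqrt_pos.2 hσ2pos
  have hσsq : σ ^ 2 = σ2 := Real.sq_sqrt hσ2pos.le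
  obtain ⟨hys, hzs, -, -, hb0, -⟩ := contactB_facts hy hz
  have hγ := deriv_contactB_exp_eq_perron hy hz
  have hαeq := perronTaylorA_eq_two_mul_contactB hy hz
  obtain ⟨A₀, L, t₀, K, Θ, hA₀, hL0, ht₀, hK0, hΘ0, hΘ, -, hreal, H⟩ := exists_complex_two_term_real_amplitude hy hz c
  obtain ⟨t₂, ht₂, K₃, hK₃0, HT⟩ := exists_norm_log_root_div_sub_le hy hz L
  set s := stripMuY₂ 1 y z ^ 2 with hs
  have hs0 : 0 < s := hy.trans hys
  set b := contactB y z with hb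
  have hα : perronTaylorA y z / s = 2 * b := by
    rw [hαeq]; field_simp
  have hγ' : (perronTaylorA y z / 2 + perronTaylorB y z) / s - (perronTaylorA y z / s) ^ 2 / 2 = σ ^ 2 := by
    rw [hσsq, hσ2, hγ]
  clear_value σ σ2
  -- the geometric rate
  set s₁ := s - L * t₀ with hs₁
  have hs₁Θ : Θ < s₁ := hΘ
  have hs₁0 : 0 < s₁ := lt_of_le_of_lt hΘ0 hs₁Θ
  have hs₁s : s₁ ≤ s := by rw [hs₁]; nlinarith [hL0, ht₀]
  set ϑ := Θ / s₁ with hϑ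
  have hϑ0 : 0 ≤ ϑ := div_nonneg hΘ0 hs₁0.le
  have hϑ1 : ϑ < 1 := (div_lt_one hs₁0).2 hs₁Θ
  have hΘsϑ : Θ / s ≤ ϑ := by rw [hϑ]; exact div_le_div_of_nonneg_left hΘ0 hs₁0 hs₁s
  clear_value s₁ ϑ
  obtain ⟨M₀, hM₀⟩ := eventually_poly_geom_le_one (8 * K / A₀) hϑ0 hϑ1 c
  -- constants
  set Kc : ℝ := K₃ / (2 * σ ^ 3) + (c : ℝ) * b / σ + (c : ℝ) / 2 + 3 / 2 * (K / A₀) / σ with hKc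
  have hKc0 : 0 ≤ Kc := by rw [hKc]; positivity
  clear_value Kc
  set δ : ℝ := min (σ * t₀ / 2) (min (σ * t₂ / 2) (min (σ * A₀ / (2 * K + 1)) (1 / (4 * Kc + 1)))) with hδ
  have hδ0 : 0 < δ := by rw [hδ]; positivity
  have hδ1 : δ ≤ σ * t₀ / 2 := min_le_left _ _
  have hδ2 : δ ≤ σ * t₂ / 2 := le_trans (min_le_right _ _) (min_le_left _ _)
  have hδ3 : δ ≤ σ * A₀ / (2 * K + 1) := le_trans (min_le_right _ _) (le_trans (min_le_right _ _) (min_le_left _ _))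
  have hδ4 : δ ≤ 1 / (4 * Kc + 1) := le_trans (min_le_right _ _) (le_trans (min_le_right _ _) (min_le_right _ _))
  clear_value δ
  have h4Kc : 4 * Kc * δ ≤ 1 := by
    have h1 : 4 * Kc * δ ≤ 4 * Kc * (1 / (4 * Kc + 1)) := mul_le_mul_of_nonneg_left hδ4 (by positivity)
    have h2 : 4 * Kc * (1 / (4 * Kc + 1)) ≤ 1 := by
      rw [← mul_div_assoc, mul_one, div_le_one (by positivity)]; linarith only [hKc0]
    linarith only [h1, h2]
  refine ⟨δ, Kc, max 1 (2 * M₀ + c), hδ0, hKc0, h4Kc, fun M hN θ hθlo hθhi => ?_⟩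
  -- === fix N = 2M + c and θ ===
  have hN1 : 1 ≤ 2 * M + c := le_trans (le_max_left _ _) hN
  have hMM₀ : M₀ ≤ M := by have := le_trans (le_max_right _ _) hN; omega
  set Nr : ℝ := ((2 * M + c : ℕ) : ℝ) with hNr
  have hNr1 : 1 ≤ Nr := by rw [hNr]; exact_mod_cast hN1
  have hNr0 : 0 < Nr := by linarith only [hNr1]
  set sqN := Real.sqrt Nr with hsqN
  have hsqN0 : 0 < sqN := Real.sqrt_pos.2 hNr0
  have hsqNsq : sqN ^ 2 = Nr := Real.sq_sqrt hNr0.le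
  have hsqN1 : 1 ≤ sqN := by rw [hsqN]; exact Real.one_le_sqrt.2 hNr1
  have hNrM : Nr = 2 * (M : ℝ) + c := by rw [hNr]; push_cast; ring
  clear_value sqN
  have hθ0 : 0 < |θ| := lt_trans (by positivity) hθlo
  -- the tilt
  set t : ℝ := θ / (σ * sqN) with ht
  have htabs : |t| = |θ| / (σ * sqN) := by rw [ht, abs_div, abs_of_pos (mul_pos hσpos hsqN0)]
  have htδ : |t| < δ / σ := by
    rw [htabs, div_lt_div_iff₀ (mul_pos hσpos hsqN0) hσpos]
    calc |θ| * σ < δ * sqN * σ := mul_lt_mul_of_pos_right hθhi hσpos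
      _ = δ * (σ * sqN) := by ring
  have ht₀' : |t| < t₀ := by
    have : δ / σ ≤ t₀ / 2 := by rw [div_le_iff₀ hσpos]; linarith only [hδ1]
    linarith only [htδ, this, ht₀]
  have ht₂' : |t| < t₂ := by
    have : δ / σ ≤ t₂ / 2 := by rw [div_le_iff₀ hσpos]; linarith only [hδ2]
    linarith only [htδ, this, ht₂]
  have hKt : K * |t| ≤ A₀ / 2 := by
    have h1 : δ / σ ≤ A₀ / (2 * K + 1) := by
      rw [div_le_iff₀ hσpos]; calc δ ≤ σ * A₀ / (2 * K + 1) := hδ3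
        _ = A₀ / (2 * K + 1) * σ := by ring
    have h2 : K * |t| ≤ K * (A₀ / (2 * K + 1)) := mul_le_mul_of_nonneg_left (by linarith only [htδ, h1]) hK0
    have h3 : K * (A₀ / (2 * K + 1)) ≤ A₀ / 2 := by
      rw [show K * (A₀ / (2 * K + 1)) = A₀ / 2 * (2 * K / (2 * K + 1)) by field_simp]
      have : 2 * K / (2 * K + 1) ≤ 1 := by rw [div_le_one (by positivity)]; linarith only [hK0]
      exact mul_le_of_le_one_right (by positivity) this
    linarith only [h2, h3]
  -- the data at t and at 0
  obtain ⟨s', A, hF, hd, hAd, hMt⟩ := H t ht₀'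
  have hcum := HT t ht₂' s' hF hd
  have hrealM := hreal M
  have hMt' := hMt M
  -- basic nonvanishing
  have hsC : ((s : ℂ)) ≠ 0 := by exact_mod_cast hs0.ne'
  have hsn : ‖(s : ℂ)‖ = s := by rw [Complex.norm_real, Real.norm_of_nonneg hs0.le]
  have hs'low : s₁ ≤ ‖s'‖ := by
    have h1 : ‖(s : ℂ)‖ ≤ ‖s'‖ + ‖s' - (s : ℂ)‖ := by
      have h := norm_add_le s' ((s : ℂ) - s'); rw [add_sub_cancel] at h; rwa [norm_sub_rev] at h
    rw [hsn] at h1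
    have h2 : L * |t| ≤ L * t₀ := mul_le_mul_of_nonneg_left ht₀'.le hL0
    linarith only [h1, hd, h2, hs₁]
  have hs'0 : s' ≠ 0 := by
    intro h; rw [h, norm_zero] at hs'low; linarith only [hs'low, hs₁0]
  have hA₀C : ((A₀ : ℂ)) ≠ 0 := by exact_mod_cast hA₀.ne'
  have hA₀n : ‖(A₀ : ℂ)‖ = A₀ := by rw [Complex.norm_real, Real.norm_of_nonneg hA₀.le]
  have hAlow : A₀ / 2 ≤ ‖A‖ := by
    have h1 : ‖(A₀ : ℂ)‖ ≤ ‖A‖ + ‖A - (A₀ : ℂ)‖ := by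
      have h := norm_add_le A ((A₀ : ℂ) - A); rw [add_sub_cancel] at h; rwa [norm_sub_rev] at h
    rw [hA₀n] at h1
    linarith only [h1, hAd, hKt]
  have hA0 : A ≠ 0 := by
    intro h; rw [h, norm_zero] at hAlow; linarith only [hAlow, hA₀]
  have hCy : 0 < stripZ₂ 1 (2 * M + c) y z := stripZ₂_pos 1 _ hy hz
  have hCyC : ((stripZ₂ 1 (2 * M + c) y z : ℝ) : ℂ) ≠ 0 := by exact_mod_cast hCy.ne'
  -- the characteristic function, factorised
  have hσinv : (σ)⁻¹ * θ = t * sqN := by rw [ht]; field_simp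
  have hchar := charFun_contactLaw_map hy hz (2 * M + c) σ⁻¹ θ
  have hsqNC : (sqN : ℂ) ≠ 0 := by exact_mod_cast hsqN0.ne'
  have hexp1 : ((σ⁻¹ * θ : ℝ) : ℂ) / (Real.sqrt ((2 * M + c : ℕ) : ℝ) : ℂ) * I = (t : ℂ) * I := by
    have e1 : ((σ⁻¹ * θ : ℝ) : ℂ) = (t : ℂ) * (sqN : ℂ) := by rw [hσinv]; push_cast; ring
    have e2 : (Real.sqrt ((2 * M + c : ℕ) : ℝ) : ℂ) = (sqN : ℂ) := by rw [hsqN, hNr]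
    rw [e1, e2, mul_div_cancel_right₀ _ hsqNC]
  rw [hexp1, ← hNr, ← hsqN] at hchar
  set φph : ℂ := -(((σ⁻¹ * θ : ℝ) : ℂ) * (sqN : ℂ) * (b : ℂ) * I) with hφph
  set Cw : ℂ := stripZ₂C 1 (2 * M + c) ((y : ℂ) * cexp ((t : ℂ) * I)) (z : ℂ) with hCw
  set E : ℂ := (M : ℂ) * Complex.log (s' / (s : ℂ)) + Complex.log (A / (A₀ : ℂ)) + φph + (θ : ℂ) ^ 2 / 2 with hE
  set q : ℂ := (Cw / (A * s' ^ M)) / (((stripZ₂ 1 (2 * M + c) y z : ℝ) : ℂ) / ((A₀ : ℂ) * (s : ℂ) ^ M)) with hq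
  have hshape := charFun_shape (Cw := Cw) (φ := φph) (θ := θ) (M := M) hCyC hA0 hA₀C hsC hs'0
  refine ⟨E, q, by rw [hchar, hb] at *; rw [hE, hq, hφph]; exact hshape, ?_, ?_⟩
  · -- ‖E‖ ≤ Kc (|θ| + |θ|³)/√N
    -- the four pieces
    have hR : ‖Complex.log (s' / (s : ℂ)) - ((2 * b : ℝ) : ℂ) * ((t : ℂ) * I) + ((σ ^ 2 : ℝ) : ℂ) * (t : ℂ) ^ 2‖ ≤ K₃ * |t| ^ 3 := by
      have h := hcum
      rw [hγ', hα] at h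
      exact h
    have hu : ‖(A - (A₀ : ℂ)) / (A₀ : ℂ)‖ ≤ K / A₀ * |t| := by
      rw [norm_div, hA₀n, div_le_iff₀ hA₀]
      calc ‖A - (A₀ : ℂ)‖ ≤ K * |t| := hAd
        _ = K / A₀ * |t| * A₀ := by field_simp
    have hu2 : ‖(A - (A₀ : ℂ)) / (A₀ : ℂ)‖ ≤ 1 / 2 := by
      refine hu.trans ?_
      rw [div_mul_eq_mul_div, div_le_iff₀ hA₀]; linarith only [hKt]
    have hLA : ‖Complex.log (A / (A₀ : ℂ))‖ ≤ 3 / 2 * (K / A₀ * |t|) := by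
      have e : A / (A₀ : ℂ) = 1 + (A - (A₀ : ℂ)) / (A₀ : ℂ) := by field_simp; ring
      rw [e]
      exact (Complex.norm_log_one_add_half_le_self hu2).trans (mul_le_mul_of_nonneg_left hu (by norm_num))
    -- decomposition of E (quadratic mismatch written as `c σ² t²/2 = c θ²/(2N)`)
    have hsq2 : ((sqN : ℂ)) ^ 2 = 2 * (M : ℂ) + (c : ℂ) := by
      have h1 : ((sqN ^ 2 : ℝ) : ℂ) = ((2 * (M : ℝ) + c : ℝ) : ℂ) := by rw [hsqNsq, hNrM]
      push_cast at h1; exact h1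
    have hEsplit : E = (M : ℂ) * (Complex.log (s' / (s : ℂ)) - ((2 * b : ℝ) : ℂ) * ((t : ℂ) * I) + ((σ ^ 2 : ℝ) : ℂ) * (t : ℂ) ^ 2)
        + (-(((c : ℝ) * b * t : ℝ) : ℂ) * I) + (((c : ℝ) * σ ^ 2 * t ^ 2 / 2 : ℝ) : ℂ) + Complex.log (A / (A₀ : ℂ)) := by
      have hθt : (θ : ℂ) = (t : ℂ) * (σ : ℂ) * (sqN : ℂ) := by
        rw [ht]; push_cast
        have : (σ : ℂ) ≠ 0 := by exact_mod_cast hσpos.ne'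
        field_simp
      rw [hE, hφph, hσinv]
      push_cast
      rw [hθt]
      linear_combination (-(t : ℂ) * (b : ℂ) * I + (t : ℂ) ^ 2 * (σ : ℂ) ^ 2 / 2) * hsq2
    -- sizes of the pieces in terms of θ
    have hP0 : 0 ≤ |θ| + |θ| ^ 3 := by positivity
    have h2M : 2 * (M : ℝ) ≤ Nr := by rw [hNrM]; linarith only [Nat.cast_nonneg (α := ℝ) c]
    have hMfrac : (M : ℝ) / Nr ≤ 1 / 2 := by rw [div_le_iff₀ hNr0]; linarith only [h2M]
    have hθsq : θ ^ 2 ≤ |θ| + |θ| ^ 3 := sq_le_abs_add_abs_cube θ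
    have hi : (M : ℝ) * (K₃ * |t| ^ 3) ≤ K₃ / (2 * σ ^ 3) * (|θ| + |θ| ^ 3) / sqN := by
      have e1 : (M : ℝ) * (K₃ * |t| ^ 3) = K₃ / σ ^ 3 * |θ| ^ 3 / sqN * ((M : ℝ) / Nr) := by
        rw [htabs, ← hsqNsq]; field_simp
      rw [e1]
      have hc0 : 0 ≤ K₃ / σ ^ 3 * |θ| ^ 3 / sqN := by positivity
      calc K₃ / σ ^ 3 * |θ| ^ 3 / sqN * ((M : ℝ) / Nr) ≤ K₃ / σ ^ 3 * |θ| ^ 3 / sqN * (1 / 2) :=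
            mul_le_mul_of_nonneg_left hMfrac hc0
        _ = K₃ / (2 * σ ^ 3) * |θ| ^ 3 / sqN := by ring
        _ ≤ K₃ / (2 * σ ^ 3) * (|θ| + |θ| ^ 3) / sqN := by
            gcongr; linarith only [abs_nonneg θ]
    have hii : ‖(-(((c : ℝ) * b * t : ℝ) : ℂ) * I)‖ ≤ (c : ℝ) * b / σ * (|θ| + |θ| ^ 3) / sqN := by
      rw [norm_mul, norm_neg, Complex.norm_real, norm_I, mul_one, Real.norm_eq_abs, abs_mul, abs_mul,
        abs_of_nonneg (Nat.cast_nonneg c), abs_of_pos hb0, htabs]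
      have e1 : (c : ℝ) * b * (|θ| / (σ * sqN)) = (c : ℝ) * b / σ * |θ| / sqN := by field_simp
      rw [e1]
      gcongr
      linarith only [pow_nonneg (abs_nonneg θ) 3]
    have hiii : ‖(((c : ℝ) * σ ^ 2 * t ^ 2 / 2 : ℝ) : ℂ)‖ ≤ (c : ℝ) / 2 * (|θ| + |θ| ^ 3) / sqN := by
      rw [Complex.norm_real, Real.norm_of_nonneg (by positivity)]
      have e1 : (c : ℝ) * σ ^ 2 * t ^ 2 / 2 = (c : ℝ) / 2 * θ ^ 2 / sqN * (1 / sqN) := by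
        rw [ht, ← sq_abs θ, ← sq_abs (θ / (σ * sqN)), abs_div, abs_of_pos (mul_pos hσpos hsqN0)]
        field_simp
      rw [e1]
      have hc0 : 0 ≤ (c : ℝ) / 2 * θ ^ 2 / sqN := by positivity
      calc (c : ℝ) / 2 * θ ^ 2 / sqN * (1 / sqN) ≤ (c : ℝ) / 2 * θ ^ 2 / sqN * 1 :=
            mul_le_mul_of_nonneg_left (by rw [div_le_one hsqN0]; exact hsqN1) hc0
        _ = (c : ℝ) / 2 * θ ^ 2 / sqN := mul_one _
        _ ≤ (c : ℝ) / 2 * (|θ| + |θ| ^ 3) / sqN := by gcongr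
    have hiv : 3 / 2 * (K / A₀ * |t|) ≤ 3 / 2 * (K / A₀) / σ * (|θ| + |θ| ^ 3) / sqN := by
      rw [htabs]
      have e1 : 3 / 2 * (K / A₀ * (|θ| / (σ * sqN))) = 3 / 2 * (K / A₀) / σ * |θ| / sqN := by field_simp
      rw [e1]
      gcongr
      linarith only [pow_nonneg (abs_nonneg θ) 3]
    rw [hEsplit]
    have hM0 : (0 : ℝ) ≤ (M : ℝ) := Nat.cast_nonneg M
    calc ‖(M : ℂ) * (Complex.log (s' / (s : ℂ)) - ((2 * b : ℝ) : ℂ) * ((t : ℂ) * I) + ((σ ^ 2 : ℝ) : ℂ) * (t : ℂ) ^ 2)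
          + (-(((c : ℝ) * b * t : ℝ) : ℂ) * I) + (((c : ℝ) * σ ^ 2 * t ^ 2 / 2 : ℝ) : ℂ) + Complex.log (A / (A₀ : ℂ))‖
        ≤ ‖(M : ℂ) * (Complex.log (s' / (s : ℂ)) - ((2 * b : ℝ) : ℂ) * ((t : ℂ) * I) + ((σ ^ 2 : ℝ) : ℂ) * (t : ℂ) ^ 2)‖
          + ‖(-(((c : ℝ) * b * t : ℝ) : ℂ) * I)‖ + ‖(((c : ℝ) * σ ^ 2 * t ^ 2 / 2 : ℝ) : ℂ)‖ + ‖Complex.log (A / (A₀ : ℂ))‖ := by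
          refine (norm_add_le _ _).trans (add_le_add ((norm_add_le _ _).trans (add_le_add (norm_add_le _ _) le_rfl)) le_rfl)
      _ ≤ K₃ / (2 * σ ^ 3) * (|θ| + |θ| ^ 3) / sqN + (c : ℝ) * b / σ * (|θ| + |θ| ^ 3) / sqN
          + (c : ℝ) / 2 * (|θ| + |θ| ^ 3) / sqN + 3 / 2 * (K / A₀) / σ * (|θ| + |θ| ^ 3) / sqN := by
          have h1 : ‖(M : ℂ) * (Complex.log (s' / (s : ℂ)) - ((2 * b : ℝ) : ℂ) * ((t : ℂ) * I) + ((σ ^ 2 : ℝ) : ℂ) * (t : ℂ) ^ 2)‖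
              ≤ (M : ℝ) * (K₃ * |t| ^ 3) := by
            rw [norm_mul, Complex.norm_natCast]; exact mul_le_mul_of_nonneg_left hR hM0
          linarith only [h1, hi, hii, hiii, hiv, hLA]
      _ = Kc * (|θ| + |θ| ^ 3) / sqN := by rw [hKc]; ring
  · -- the geometric factor
    set ε₁ : ℂ := Cw / (A * s' ^ M) - 1 with hε₁
    set ε₀ : ℂ := ((stripZ₂ 1 (2 * M + c) y z : ℝ) : ℂ) / ((A₀ : ℂ) * (s : ℂ) ^ M) - 1 with hε₀
    have hqε : q = (1 + ε₁) / (1 + ε₀) := by rw [hq, hε₁, hε₀]; ring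
    set η : ℝ := 2 * K / A₀ * ((M : ℝ) + 1) * ϑ ^ M with hη
    have hAsM : A * s' ^ M ≠ 0 := mul_ne_zero hA0 (pow_ne_zero _ hs'0)
    have hA₀sM : (A₀ : ℂ) * (s : ℂ) ^ M ≠ 0 := mul_ne_zero hA₀C (pow_ne_zero _ hsC)
    have hs'M : s₁ ^ M ≤ ‖s'‖ ^ M := pow_le_pow_left₀ hs₁0.le hs'low M
    have hΘϑ : Θ = ϑ * s₁ := by rw [hϑ]; field_simp
    have hη0 : 0 ≤ η := by rw [hη]; positivity
    have hε₁b : ‖ε₁‖ ≤ η := by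
      have e1 : ε₁ = (Cw - A * s' ^ M) / (A * s' ^ M) := by rw [hε₁]; field_simp
      rw [e1, norm_div, norm_mul, norm_pow, div_le_iff₀ (by positivity)]
      calc ‖Cw - A * s' ^ M‖ ≤ K * ((M : ℝ) + 1) * Θ ^ M := hMt'
        _ = η * ((A₀ / 2) * s₁ ^ M) := by rw [hη, hΘϑ, mul_pow]; field_simp
        _ ≤ η * (‖A‖ * ‖s'‖ ^ M) :=
            mul_le_mul_of_nonneg_left (mul_le_mul hAlow hs'M (by positivity) (norm_nonneg _)) hη0
    have hε₀b : ‖ε₀‖ ≤ η := by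
      have hsM : (0 : ℝ) < s ^ M := pow_pos hs0 M
      have e1 : ε₀ = (((stripZ₂ 1 (2 * M + c) y z - A₀ * s ^ M : ℝ) : ℂ)) / ((A₀ : ℂ) * (s : ℂ) ^ M) := by
        rw [hε₀]; push_cast; field_simp
      rw [e1, norm_div, norm_mul, norm_pow, Complex.norm_real, hA₀n, hsn, Real.norm_eq_abs, div_le_iff₀ (by positivity)]
      have hΘs : Θ ^ M ≤ ϑ ^ M * s ^ M := by
        rw [← mul_pow]; exact pow_le_pow_left₀ hΘ0 (by rw [hΘϑ]; exact mul_le_mul_of_nonneg_left hs₁s hϑ0) M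
      calc |stripZ₂ 1 (2 * M + c) y z - A₀ * s ^ M| ≤ K * ((M : ℝ) + 1) * Θ ^ M := hrealM
        _ ≤ K * ((M : ℝ) + 1) * (ϑ ^ M * s ^ M) := mul_le_mul_of_nonneg_left hΘs (by positivity)
        _ = (K / A₀ * ((M : ℝ) + 1) * ϑ ^ M) * (A₀ * s ^ M) := by field_simp
        _ ≤ η * (A₀ * s ^ M) := by
            refine mul_le_mul_of_nonneg_right ?_ (by positivity)
            rw [hη]
            have : 0 ≤ K / A₀ * ((M : ℝ) + 1) * ϑ ^ M := by positivity
            rw [show 2 * K / A₀ * ((M : ℝ) + 1) * ϑ ^ M = 2 * (K / A₀ * ((M : ℝ) + 1) * ϑ ^ M) by ring]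
            linarith only [this]
    -- η ≤ 1/4 and 4η ≤ 1/N, from the choice of N₀
    have hgeo := hM₀ M hMM₀
    have hNrle : 8 * K / A₀ * ((M : ℝ) + 1) * ϑ ^ M * (Nr + 1) ≤ 1 := by
      have e : 8 * K / A₀ * ((M : ℝ) + 1) * ϑ ^ M * (Nr + 1) = 8 * K / A₀ * (((M : ℝ) + 1) * (Nr + 1)) * ϑ ^ M := by ring
      rw [e, hNr]; exact hgeo
    have h4η : 4 * η ≤ 1 / (Nr + 1) := by
      rw [le_div_iff₀ (by positivity), hη]
      calc 4 * (2 * K / A₀ * ((M : ℝ) + 1) * ϑ ^ M) * (Nr + 1) = 8 * K / A₀ * ((M : ℝ) + 1) * ϑ ^ M * (Nr + 1) := by ring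
        _ ≤ 1 := hNrle
    have hη4 : η ≤ 1 / 4 := by
      have : 1 / (Nr + 1) ≤ 1 := by rw [div_le_one (by positivity)]; linarith only [hNr0]
      linarith only [h4η, this]
    obtain ⟨hq2, hq1⟩ := norm_ratio_le hε₁b hε₀b hη4
    rw [← hqε] at hq2 hq1
    refine ⟨hq2, hq1.trans ?_⟩
    -- 4η ≤ 1/(N+1) ≤ 1/N < |θ|/√N
    have hθN : 1 / Nr < 1 * |θ| / sqN := by
      rw [one_mul, div_lt_div_iff₀ hNr0 hsqN0, ← hsqNsq, one_mul]
      have h := (div_lt_iff₀ hsqN0).1 hθlo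
      nlinarith only [h, hsqN0]
    have h1 : 1 / (Nr + 1) ≤ 1 / Nr := one_div_le_one_div_of_le hNr0 (by linarith only [])
    linarith only [h4η, h1, hθN]

/-! ## §4 ★★★ The Berry–Esseen rate -/

/-- Gluing the two parities of `exists_outer_window`. [cite: Durrett2019, §3.4.4 Theorem 3.4.17 (lane plumbing)] -/
private theorem exists_outer_window_all (hy : 0 < y) (hz : 0 < z) :
    ∃ δ Kc : ℝ, ∃ N₀ : ℕ, 0 < δ ∧ 0 ≤ Kc ∧ 4 * Kc * δ ≤ 1 ∧
      ∀ N : ℕ, N₀ ≤ N → ∀ θ : ℝ, 1 / Real.sqrt (N : ℝ) < |θ| → |θ| < δ * Real.sqrt (N : ℝ) →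
        ∃ E q : ℂ,
          charFun ((contactLaw y z N).map
              (fun u => (Real.sqrt (deriv (fun A => contactB (Real.exp A) z) (Real.log y)))⁻¹ * u)) θ
            = cexp (-((θ : ℂ) ^ 2 / 2) + E) * q ∧
          ‖E‖ ≤ Kc * (|θ| + |θ| ^ 3) / Real.sqrt (N : ℝ) ∧ ‖q‖ ≤ 2 ∧ ‖q - 1‖ ≤ 1 * |θ| / Real.sqrt (N : ℝ) := by
  obtain ⟨δ₀, K₀, N₀, hδ₀, hK₀, h4₀, H₀⟩ := exists_outer_window hy hz 0
  obtain ⟨δ₁, K₁, N₁, hδ₁, hK₁, h4₁, H₁⟩ := exists_outer_window hy hz 1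
  refine ⟨min δ₀ δ₁, max K₀ K₁, max N₀ N₁, lt_min hδ₀ hδ₁, le_max_of_le_left hK₀, ?_, fun N hN θ hlo hhi => ?_⟩
  · rcases le_total K₀ K₁ with h | h
    · rw [max_eq_right h]
      calc 4 * K₁ * min δ₀ δ₁ ≤ 4 * K₁ * δ₁ := mul_le_mul_of_nonneg_left (min_le_right _ _) (by positivity)
        _ ≤ 1 := h4₁
    · rw [max_eq_left h]
      calc 4 * K₀ * min δ₀ δ₁ ≤ 4 * K₀ * δ₀ := mul_le_mul_of_nonneg_left (min_le_left _ _) (by positivity)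
        _ ≤ 1 := h4₀
  · obtain ⟨M, hM⟩ : ∃ M, N = 2 * M + N % 2 := ⟨N / 2, by omega⟩
    have hsq0 : 0 ≤ Real.sqrt (N : ℝ) := Real.sqrt_nonneg _
    rcases Nat.mod_two_eq_zero_or_one N with h0 | h1
    · rw [h0] at hM
      have hN' : N₀ ≤ 2 * M + 0 := by rw [← hM]; exact le_trans (le_max_left _ _) hN
      have hcast : ((2 * M + 0 : ℕ) : ℝ) = (N : ℝ) := by rw [← hM]
      obtain ⟨E, q, hφ, hE, hq, hq1⟩ := H₀ M hN' θ (by rw [hcast]; exact hlo)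
        (by rw [hcast]; exact lt_of_lt_of_le hhi (mul_le_mul_of_nonneg_right (min_le_left _ _) hsq0))
      rw [hcast] at hE hq1
      rw [show 2 * M + 0 = N from hM.symm] at hφ
      exact ⟨E, q, hφ, hE.trans (by gcongr; exact le_max_left _ _), hq, hq1⟩
    · rw [h1] at hM
      have hN' : N₁ ≤ 2 * M + 1 := by rw [← hM]; exact le_trans (le_max_right _ _) hN
      have hcast : ((2 * M + 1 : ℕ) : ℝ) = (N : ℝ) := by rw [← hM]
      obtain ⟨E, q, hφ, hE, hq, hq1⟩ := H₁ M hN' θ (by rw [hcast]; exact hlo)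
        (by rw [hcast]; exact lt_of_lt_of_le hhi (mul_le_mul_of_nonneg_right (min_le_right _ _) hsq0))
      rw [hcast] at hE hq1
      rw [show 2 * M + 1 = N from hM.symm] at hφ
      exact ⟨E, q, hφ, hE.trans (by gcongr; exact le_max_right _ _), hq, hq1⟩

open Classical in
/-- ★★★ **THE BERRY–ESSEEN RATE FOR THE CONTACT NUMBER.**  For all `y, z > 0` there is a constant `C = C(y,z)` such that for EVERY `N ≥ 1` and EVERY
real `x`, `|P_{N,y,z}(bc ≤ N·b(y,z) + x·σ·√N) − Φ(x)| ≤ C/√N`, where `b(y,z)` is the contact density, `σ² = d/dA b(e^A,z)|_{A = log y} > 0` the CLT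
variance (`tendsto_contactLaw`) and `Φ` the standard normal distribution function.  The law of an integer statistic has jumps `≍ 1/√N`, so the rate is
optimal.  Proof: `abs_cdf_sub_gaussian_le_rate_two_windows` with the inner window `|θ| ≤ 1/√N` (`exists_inner_window`) and the outer window
`1/√N < |θ| < δ√N` (`exists_outer_window`: complex two-term asymptotics of the partition function at fugacity `ye^{iθ/(σ√N)}`, `norm_sub_gauss_le_of_cubic_mul`);
small `N` by the trivial bound.
[cite: Durrett2019, §3.4.4 Theorem 3.4.17 (the Berry–Esseen rate; lane statement for the strip contact number); Feller1971, XVI.5; BeatonBousquetMelouDeGierDuminilCopinGuttmann2014, §3.2 Proposition 6 (arXiv v5 p. 10)] -/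
theorem contact_berryEsseen (hy : 0 < y) (hz : 0 < z) :
    ∃ C : ℝ, ∀ N : ℕ, 1 ≤ N → ∀ x : ℝ,
      |(∑ q ∈ (stripPairs 1 N).filter (fun q => (bottomVisits₀ q.1 q.2 N : ℝ) ≤
            N * contactB y z + x * Real.sqrt (deriv (fun A => contactB (Real.exp A) z) (Real.log y)) * Real.sqrt N), wgt y z N q)
          / stripZ₂ 1 N y z
        - (gaussianReal 0 1).real (Iic x)| ≤ C / Real.sqrt N := by
  set σ2 := deriv (fun A => contactB (Real.exp A) z) (Real.log y) with hσ2
  have hσ2pos : 0 < σ2 := deriv_contactB_exp_pos hy hz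
  set σ := Real.sqrt σ2 with hσ
  have hσpos : 0 < σ := Real.sqrt_pos.2 hσ2pos
  obtain ⟨A₁, hA₁0, Hin⟩ := exists_inner_window hy hz (a := σ⁻¹) (by positivity)
  obtain ⟨δ, Kc, N₀, hδ, hKc0, h4, Hout⟩ := exists_outer_window_all hy hz
  -- the family `n ↦ law at N = n + N₁`
  set N₁ : ℕ := max N₀ 1 with hN₁
  set μs : ℕ → Measure ℝ := fun n => (contactLaw y z (n + N₁)).map (fun u => σ⁻¹ * u) with hμs
  haveI : ∀ n, IsProbabilityMeasure (μs n) := fun n => isProbabilityMeasure_contactLaw_map hy hz _ _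
  set r : ℕ → ℝ := fun n => Real.sqrt ((n + N₁ : ℕ) : ℝ) with hr
  have hr0 : ∀ n, 0 < r n := fun n => Real.sqrt_pos.2 (by rw [hN₁]; positivity)
  have hrate := abs_cdf_sub_gaussian_le_rate_two_windows (μs := μs) (r := r) (c := 1) (A₁ := A₁) (a := 6 * Kc + 1) (b := 6 * Kc)
    hδ zero_le_one hA₁0 (by positivity) (by positivity) hr0
    (fun n θ hθ => by
      have hr1 : 1 ≤ r n := by
        rw [hr]; exact Real.one_le_sqrt.2 (by rw [hN₁]; exact_mod_cast le_trans (le_max_right N₀ 1) (Nat.le_add_left _ _))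
      exact Hin (n + N₁) θ (hθ.trans (by rw [div_le_one (hr0 n)]; exact hr1)))
    (fun n θ hlo hhi => by
      have hN : N₀ ≤ n + N₁ := le_trans (le_max_left _ _) (Nat.le_add_left _ _)
      obtain ⟨E, q, hφ, hE, hq, hq1⟩ := Hout (n + N₁) hN θ hlo hhi
      rw [hμs]
      simp only
      rw [hφ]
      have hθ4 : 4 * Kc * |θ| ≤ r n := by
        calc 4 * Kc * |θ| ≤ 4 * Kc * (δ * r n) := mul_le_mul_of_nonneg_left hhi.le (by positivity)
          _ = (4 * Kc * δ) * r n := by ring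
          _ ≤ 1 * r n := mul_le_mul_of_nonneg_right h4 (hr0 n).le
          _ = r n := one_mul _
      have h := norm_sub_gauss_le_of_cubic_mul hKc0 (hr0 n) hθ4 hE hq hq1
      rw [mul_div_assoc]
      convert h using 2)
  -- the constant
  refine ⟨max (((2 * 1 * A₁ + (2 * (6 * Kc + 1) + 4 * (6 * Kc)) * Real.sqrt Real.pi) / Real.pi + 48 / (5 * Real.pi * δ)))
    (Real.sqrt N₁), fun N hN x => ?_⟩
  by_cases hsmall : N < N₁
  · -- small N: the trivial bound
    have hP : 0 ≤ (∑ q ∈ (stripPairs 1 N).filter (fun q => (bottomVisits₀ q.1 q.2 N : ℝ) ≤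
            N * contactB y z + x * σ * Real.sqrt N), wgt y z N q) / stripZ₂ 1 N y z ∧
        (∑ q ∈ (stripPairs 1 N).filter (fun q => (bottomVisits₀ q.1 q.2 N : ℝ) ≤
            N * contactB y z + x * σ * Real.sqrt N), wgt y z N q) / stripZ₂ 1 N y z ≤ 1 := by
      constructor
      · exact div_nonneg (Finset.sum_nonneg fun q _ => wgt_nonneg hy.le hz.le N q) (stripZ₂_pos 1 N hy hz).le
      · rw [div_le_one (stripZ₂_pos 1 N hy hz), stripZ₂_one_eq_sum_wgt]
        exact Finset.sum_le_sum_of_subset_of_nonneg (Finset.filter_subset _ _) fun q _ _ => wgt_nonneg hy.le hz.le N q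
    have hG : 0 ≤ (gaussianReal 0 1).real (Iic x) ∧ (gaussianReal 0 1).real (Iic x) ≤ 1 :=
      ⟨measureReal_nonneg, measureReal_le_one⟩
    have hsqN : 0 < Real.sqrt (N : ℝ) := Real.sqrt_pos.2 (by exact_mod_cast hN)
    rw [le_div_iff₀ hsqN]
    have hle1 : |(∑ q ∈ (stripPairs 1 N).filter (fun q => (bottomVisits₀ q.1 q.2 N : ℝ) ≤
            N * contactB y z + x * σ * Real.sqrt N), wgt y z N q) / stripZ₂ 1 N y z - (gaussianReal 0 1).real (Iic x)| ≤ 1 := by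
      rw [abs_le]; constructor <;> linarith [hP.1, hP.2, hG.1, hG.2]
    have hsq : Real.sqrt (N : ℝ) ≤ Real.sqrt (N₁ : ℝ) := Real.sqrt_le_sqrt (by exact_mod_cast hsmall.le)
    calc |_| * Real.sqrt (N : ℝ) ≤ 1 * Real.sqrt (N₁ : ℝ) := mul_le_mul hle1 hsq hsqN.le zero_le_one
      _ ≤ max _ (Real.sqrt (N₁ : ℝ)) := by rw [one_mul]; exact le_max_right _ _
  · -- N ≥ N₁: the rate
    have hge : N₁ ≤ N := not_lt.1 hsmall
    obtain ⟨n, rfl⟩ : ∃ n, N = n + N₁ := ⟨N - N₁, by omega⟩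
    have h := hrate n x
    have hcdf : (μs n).real (Iic x) = (∑ q ∈ (stripPairs 1 (n + N₁)).filter (fun q => (bottomVisits₀ q.1 q.2 (n + N₁) : ℝ) ≤
            (n + N₁ : ℕ) * contactB y z + x * σ * Real.sqrt (n + N₁ : ℕ)), wgt y z (n + N₁) q) / stripZ₂ 1 (n + N₁) y z := by
      rw [hμs]
      simp only
      rw [contactLaw_map_real_Iic hy hz (le_trans (le_max_right N₀ 1) (Nat.le_add_left _ _)) (by positivity) x]
      congr 3
      ext q
      rw [div_inv_eq_mul]
    rw [hcdf] at h
    refine h.trans ?_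
    rw [hr]
    exact div_le_div_of_nonneg_right (le_max_left _ _) (Real.sqrt_nonneg _)

/-- `Φ(x/σ) = N(0, σ²)(−∞, x]` for `σ > 0` (the scaling `gaussianReal_map_const_mul`). [cite: Durrett2019, §3.1 (lane plumbing)] -/
theorem gaussianReal_real_Iic_div {σ2 : ℝ} (hσ2 : 0 < σ2) (x : ℝ) :
    (gaussianReal 0 1).real (Iic (x / Real.sqrt σ2)) = (gaussianReal 0 σ2.toNNReal).real (Iic x) := by
  set σ := Real.sqrt σ2 with hσ
  have hσpos : 0 < σ := Real.sqrt_pos.2 hσ2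
  have hmap := gaussianReal_map_const_mul (μ := 0) (v := 1) σ
  have hv : (NNReal.mk (σ ^ 2) (sq_nonneg _) * 1 : NNReal) = σ2.toNNReal := by
    ext
    simp [hσ, Real.sq_sqrt hσ2.le, Real.coe_toNNReal _ hσ2.le]
  rw [mul_zero, hv] at hmap
  rw [← hmap, map_measureReal_apply (measurable_const_mul σ) measurableSet_Iic]
  congr 1
  ext u
  simp only [Set.mem_preimage, Set.mem_Iic]
  rw [le_div_iff₀ hσpos, mul_comm]

open Classical in
/-- ★★★ **THE RATE IN THE UNITS OF `tendsto_contactCDF`**: for all `y, z > 0` there is `C` with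
`|P_{N,y,z}(bc ≤ N·b + x√N) − N(0, σ²)(−∞, x]| ≤ C/√N` for every `N ≥ 1` and every real `x` (`σ² = ∂b/∂A`).
[cite: Durrett2019, §3.4.4 Theorem 3.4.17 (lane statement); BeatonBousquetMelouDeGierDuminilCopinGuttmann2014, §3.2 Proposition 6 (arXiv v5 p. 10)] -/
theorem contact_berryEsseen' (hy : 0 < y) (hz : 0 < z) :
    ∃ C : ℝ, ∀ N : ℕ, 1 ≤ N → ∀ x : ℝ,
      |(∑ q ∈ (stripPairs 1 N).filter (fun q => (bottomVisits₀ q.1 q.2 N : ℝ) ≤ N * contactB y z + x * Real.sqrt N), wgt y z N q)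
          / stripZ₂ 1 N y z
        - (gaussianReal 0 (deriv (fun A => contactB (Real.exp A) z) (Real.log y)).toNNReal).real (Iic x)| ≤ C / Real.sqrt N := by
  set σ2 := deriv (fun A => contactB (Real.exp A) z) (Real.log y) with hσ2
  have hσ2pos : 0 < σ2 := deriv_contactB_exp_pos hy hz
  have hσpos : 0 < Real.sqrt σ2 := Real.sqrt_pos.2 hσ2pos
  obtain ⟨C, hC⟩ := contact_berryEsseen hy hz
  refine ⟨C, fun N hN x => ?_⟩
  have h := hC N hN (x / Real.sqrt σ2)
  rw [div_mul_cancel₀ x hσpos.ne', gaussianReal_real_Iic_div hσ2pos] at h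
  exact h

open Classical in
/-- ★★★ **THE BERRY–ESSEEN RATE FOR THE TOP CONTACTS** (reflection of `contact_berryEsseen`, exchanging the walls: `sum_filter_topVisits_eq_sum_filter_bottomVisits`,
`stripZ₂_symm`): for all `y, z > 0` there is `C` with `|P_{N,y,z}(tc ≤ N·b(z,y) + x·σ_top·√N) − Φ(x)| ≤ C/√N` for every `N ≥ 1` and real `x`,
`σ_top² = d/dB b(e^B, y)|_{B = log z}`. [cite: Durrett2019, §3.4.4 Theorem 3.4.17 (lane statement); BeatonBousquetMelouDeGierDuminilCopinGuttmann2014, §3.2 Proposition 6 (arXiv v5 p. 10: symmetry of the walls)] -/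
theorem topContact_berryEsseen (hy : 0 < y) (hz : 0 < z) :
    ∃ C : ℝ, ∀ N : ℕ, 1 ≤ N → ∀ x : ℝ,
      |(∑ q ∈ (stripPairs 1 N).filter (fun q => (topVisits₀ 1 q.1 q.2 N : ℝ) ≤
            N * contactB z y + x * Real.sqrt (deriv (fun B => contactB (Real.exp B) y) (Real.log z)) * Real.sqrt N), wgt y z N q)
          / stripZ₂ 1 N y z
        - (gaussianReal 0 1).real (Iic x)| ≤ C / Real.sqrt N := by
  obtain ⟨C, hC⟩ := contact_berryEsseen hz hy
  refine ⟨C, fun N hN x => ?_⟩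
  rw [sum_filter_topVisits_eq_sum_filter_bottomVisits y z N
    (fun k => (k : ℝ) ≤ N * contactB z y + x * Real.sqrt (deriv (fun B => contactB (Real.exp B) y) (Real.log z)) * Real.sqrt N),
    stripZ₂_symm 1 N y z]
  exact hC N hN x

end WidthOneYZ

end Literature.Probability.RandomPlanarGeometry.SAW.HexBW

end
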